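import Literature.NumberTheory.Automorphic.EichlerSubidealCount
import Literature.NumberTheory.Automorphic.BrandtModuleWeightSymmProofs
import Literature.NumberTheory.Automorphic.DefiniteOrderUnitsTorsion
import HarnessLib

/-!
# Non-Eisenstein eigenvectors of the Brandt module: `p ∤ ⟨g, ·⟩` on the degree-zero part

Topic `NumberTheory/Automorphic`; theorems only (no definition, no named fact, no instance).
A brick of the definite side of Pollack–Weston 2011, Thm. 6.8 (tree: the named fact
`PollackWeston2011.thm_6_8_ellipticCurve`) and of Takahashi 2001, Thm. 2.3 (tree:
`takahashi2001_thm_2_3`): the **mod-`p` Eisenstein criterion in the Brandt module** `ℤ[Cls O]` of a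
Brandt setup `S = (D, O)` of type `(N⁺, N⁻)` (`BrandtXi.lean`).

In the printed proof of PW Thm. 6.8, hypothesis CR (i) — `ρ̄_f` irreducible, i.e. the maximal
ideal `𝔪_f` of the Hecke algebra is **non-Eisenstein** — enters through Prop. 6.3 (2) / 6.4 (1)
([Khare], [Ribet1990] Thm. 3.12: the component group `Φ_r(J₀(N))` is Eisenstein, so
`(Φ_r(J) ⊗ 𝒪)_{𝔪_f} = 0` and the image of `Φ_r(J) → Φ_r(A)` is a `𝔭`-unit); in Takahashi's
formula `δ · i_r = h_r · j_r`, `i_r j_r = c_r` (Thm. 2.3, tree `Takahashi2001.exists_index_formula`)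
this is the statement **`p ∤ i_r`**, where (Lemma 2.2) `i_r` generates the ideal
`{u_J(g_r, y) : y ∈ X_r(J)}` and, under Ribet's isometry `X_r(J₀(rM)) ≅ ℤ[Cls O]⁰` with Gross's
pairing `⟨x, y⟩ = Σ_c w_c x_c y_c` ([Ribet1990] §3; [Gross1987] §1), `{⟨g, y⟩ : y ∈ ℤ[Cls O]⁰}` is
generated by the differences `w_c g_c - w_{c'} g_{c'}`.

What is proved here is the elementary half of that step, entirely inside the Brandt module and
with no Galois input: **if a common eigenvector `v` of the Brandt matrices `T(ℓ)` (`ℓ ∤ N⁺N⁻`),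
not divisible by `p`, had all `w_c v_c` congruent modulo `p`, then its eigenvalues would be
Eisenstein: `λ_ℓ ≡ ℓ + 1 (mod p)` for every prime `ℓ ∤ N⁺N⁻`.** Proof: `T(ℓ)` is self-adjoint for
`⟨e_i, e_j⟩ = w_i δ_ij` (`w_i T_ij = w_j T_ji`, Eichler; tree
`Brandt.XiSetup.weight_mul_matrix_symm`), so `h = (w_c v_c)_c` is an eigenvector of the TRANSPOSE
`T(ℓ)ᵀ` with the same eigenvalue `λ_ℓ`; the columns of `T(ℓ)` sum to `ℓ + 1` (Eichler's count,
tree `Brandt.XiSetup.sum_matrix_prime_eq`), i.e. `T(ℓ)ᵀ 𝟙 = (ℓ + 1) 𝟙`; reducing `h ≡ μ 𝟙 (mod p)`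
gives `λ_ℓ μ ≡ (ℓ + 1) μ`, and `μ = w_{c₀} v_{c₀}` is prime to `p` because `p ∤ w_c` for `p ≥ 5`
(the unit groups of definite orders have order dividing `24`; tree `Brandt.XiSetup.not_dvd_weight`).
Contrapositively, one non-Eisenstein eigenvalue `λ_ℓ ≢ ℓ + 1 (mod p)` produces classes `c, c'`
with `p ∤ w_c v_c - w_{c'} v_{c'}`, i.e. a degree-zero vector `y = e_c - e_{c'}` with
`p ∤ ⟨v, y⟩` — the Brandt-module form of "`p ∤ i_r`". For `λ = (a_n(E))_n` and `ρ̄_{E,p}`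
irreducible such an `ℓ` exists by Chebotarev and Brauer–Nesbitt (tree:
`not_irreducible_of_frobeniusTrace_congr_holds`); that assembly is not made in this file.

## Contents (namespace `Literature.NumberTheory.Automorphic.Brandt`)

* `sum_mul_weight_mul_eq_of_mulVec_eq_smul` — weight symmetry turns a right eigenvector `v` of `T`
  into the right eigenvector `(w_i v_i)_i` of `Tᵀ` (any commutative ring).
* `dvd_sub_of_forall_dvd_weight_mul_sub` — the abstract criterion: constant column sums `s`,
  weight symmetry, `T v = λ v`, `p` prime, `p ∤ w_{i₀} v_{i₀}`, all `w_i v_i ≡ w_j v_j (mod p)`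
  `⇒ p ∣ λ - s`.
* `XiSetup.dvd_sub_prime_add_one_of_forall_dvd` — in a Brandt setup, for `v` in the eigen-lattice
  `L(λ)` and a prime `p ≥ 5`: `p ∤ v_{c₀}` and `w_c v_c ≡ w_{c'} v_{c'} (mod p)` for all `c, c'`
  force `λ(ℓ) ≡ ℓ + 1 (mod p)` at every prime `ℓ ∤ N⁺N⁻`.
* `XiSetup.exists_not_dvd_weight_mul_sub`, `XiSetup.exists_sum_eq_zero_not_dvd_pairing` — the
  contrapositive: one prime `ℓ ∤ N⁺N⁻` with `λ(ℓ) ≢ ℓ + 1 (mod p)` gives `c, c'` with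
  `p ∤ w_c v_c - w_{c'} v_{c'}`, resp. a degree-zero `y` with `p ∤ Σ_c w_c v_c y_c`.
* `exists_not_dvd_of_eigenLattice_eq_span` — a generator of the (saturated) eigen-lattice is not
  divisible by any prime (the hypothesis `p ∤ v_{c₀}` for `v = g`, the generator of the eigen-line).

## References

* [PollackWeston2011] R. Pollack, T. Weston, Compositio Math. 147 (2011), §6.2 Prop. 6.3–6.4,
  §6.4 Prop. 6.6, §6.5 Thm. 6.8 (where CR (i) enters through `𝔪_f` non-Eisenstein).
* [Ribet1990] K. Ribet, Invent. Math. 100 (1990), §3, Thm. 3.12 (`Φ` is Eisenstein) and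
  Prop. 3.1–3.3 (character group = degree-zero divisors on supersingular points).
* [Gross1987] B. H. Gross, Heights and the special values of L-series (1987), §1–2 (the pairing
  `⟨e_i, e_j⟩ = w_i δ_ij`, the Eisenstein vector, `deg t_p = p + 1`).
* [Eichler1973] M. Eichler, LNM 320 (1973), Ch. II §6 (16)–(17) (row sums `p + 1`, symmetry).
* [Takahashi2001] S. Takahashi, J. Number Theory 90 (2001), Lemma 2.2, Thm. 2.3 (`i_r`).
-/

noncomputable section

open scoped BigOperators Matrix

universe u

namespace Literature.NumberTheory.Automorphic

namespace Brandt

/-! ### Linear algebra: weight symmetry, constant column sums, congruent weighted coordinates -/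

section Abstract

variable {ι : Type*} [Fintype ι] {R : Type*} [CommRing R]

/-- **Weight symmetry transposes eigenvectors**: if `w_i T_ij = w_j T_ji` for all `i, j` (the
matrix `T` is self-adjoint for `⟨e_i, e_j⟩ = w_i δ_ij`) and `T v = λ v`, then the vector
`h = (w_i v_i)_i` is an eigenvector of the transpose, `Σ_i T_ij h_i = λ h_j` (Eichler 1973, II §6
(17); Gross 1987 §1). [cite: Eichler1973, Ch. II §6 (17)] -/
theorem sum_mul_weight_mul_eq_of_mulVec_eq_smul (T : Matrix ι ι R) (w : ι → R) {lam : R}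
    {v : ι → R} (hsymm : ∀ i j, w i * T i j = w j * T j i) (hv : T *ᵥ v = lam • v) (j : ι) :
    ∑ i, T i j * (w i * v i) = lam * (w j * v j) := by
  have h : ∑ i, T j i * v i = lam * v j := by
    have := congrFun hv j
    simpa [Matrix.mulVec, dotProduct] using this
  calc ∑ i, T i j * (w i * v i) = ∑ i, w j * (T j i * v i) := by
        refine Finset.sum_congr rfl fun i _ => ?_
        calc T i j * (w i * v i) = (w i * T i j) * v i := by ring
          _ = (w j * T j i) * v i := by rw [hsymm i j]
          _ = w j * (T j i * v i) := by ring
    _ = w j * ∑ i, T j i * v i := by rw [Finset.mul_sum]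
    _ = lam * (w j * v j) := by rw [h]; ring

/-- **The mod-`p` Eisenstein criterion, abstract form.** Let `T` be a square matrix over a
commutative ring with constant column sums `s` (`Σ_i T_ij = s`) and self-adjoint for the weights
`w` (`w_i T_ij = w_j T_ji`), `T v = λ v`, and `p` a prime element. If `p ∤ w_{i₀} v_{i₀}` for some
`i₀` while all the weighted coordinates are congruent, `p ∣ w_i v_i - w_j v_j`, then `p ∣ λ - s`:
reducing `Σ_i T_{i i₀} (w_i v_i) = λ w_{i₀} v_{i₀}` modulo `p` gives `s μ ≡ λ μ` with
`μ = w_{i₀} v_{i₀}` prime to `p`. (Gross 1987 §2: the Eisenstein vector spans the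
`s = p + 1`-eigenspace; here modulo `p`.) [cite: Gross1987, §2 (Eisenstein vector)] -/
theorem dvd_sub_of_forall_dvd_weight_mul_sub (T : Matrix ι ι R) (w : ι → R) {lam s : R}
    {v : ι → R} (hsymm : ∀ i j, w i * T i j = w j * T j i) (hcol : ∀ j, ∑ i, T i j = s)
    (hv : T *ᵥ v = lam • v) {p : R} (hp : Prime p) {i₀ : ι} (h0 : ¬ p ∣ w i₀ * v i₀)
    (hcong : ∀ i j, p ∣ w i * v i - w j * v j) : p ∣ lam - s := by
  have heig := sum_mul_weight_mul_eq_of_mulVec_eq_smul T w hsymm hv i₀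
  -- `(λ - s) μ = Σ_i T_{i i₀} (h_i - μ)` with `μ = w_{i₀} v_{i₀}`
  have key : (lam - s) * (w i₀ * v i₀) = ∑ i, T i i₀ * (w i * v i - w i₀ * v i₀) := by
    have h1 : ∑ i, T i i₀ * (w i * v i - w i₀ * v i₀) =
        ∑ i, T i i₀ * (w i * v i) - (∑ i, T i i₀) * (w i₀ * v i₀) := by
      rw [Finset.sum_mul, ← Finset.sum_sub_distrib]
      exact Finset.sum_congr rfl fun i _ => by ring
    rw [h1, heig, hcol i₀]
    ring
  have hdvd : p ∣ (lam - s) * (w i₀ * v i₀) := by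
    rw [key]
    exact Finset.dvd_sum fun i _ => Dvd.dvd.mul_left (hcong i i₀) _
  rcases hp.dvd_or_dvd hdvd with h | h
  · exact h
  · exact absurd h h0

end Abstract

/-! ### Brandt setups: congruent weighted coordinates force Eisenstein eigenvalues -/

section Setup

variable {Nplus Nminus : ℕ}

/-- **Congruent weighted coordinates force Eisenstein eigenvalues.** Let `S` be a Brandt setup of
type `(N⁺, N⁻)`, `v ∈ L(λ)` a common eigenvector of the Brandt matrices `T(ℓ)`, `ℓ ∤ N⁺N⁻`
(`Brandt.eigenLattice`), and `p ≥ 5` a prime with `p ∤ v_{c₀}` for some class `c₀`. If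
`w_c v_c ≡ w_{c'} v_{c'} (mod p)` for all classes `c, c'` — i.e. `p` divides the pairing
`⟨v, y⟩ = Σ_c w_c v_c y_c` against every degree-zero `y` — then `λ(ℓ) ≡ ℓ + 1 (mod p)` for every
prime `ℓ ∤ N⁺N⁻`: by weight symmetry (`XiSetup.weight_mul_matrix_symm`), Eichler's column sums
`ℓ + 1` (`XiSetup.sum_matrix_prime_eq`) and `p ∤ w_{c₀}` (`XiSetup.not_dvd_weight`, `p ≥ 5`).
This is the Brandt-module shadow of "`𝔪_λ` is Eisenstein" (Ribet 1990 Thm. 3.12; Pollack–Weston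
2011 Prop. 6.3 (2)). [cite: Ribet1990, §3 Thm. 3.12] [cite: PollackWeston2011, Prop. 6.3] -/
theorem XiSetup.dvd_sub_prime_add_one_of_forall_dvd (S : XiSetup Nplus Nminus)
    [Fintype (ClassSet S.O)] {lam : ℕ → ℤ} {v : ClassSet S.O → ℤ}
    (hv : v ∈ eigenLattice (Nplus * Nminus) (matrix S.O) lam) {p : ℕ} (hp : p.Prime)
    (h5 : 5 ≤ p) {c₀ : ClassSet S.O} (hv0 : ¬ (p : ℤ) ∣ v c₀)
    (hcong : ∀ c c', (p : ℤ) ∣ (weight S.O c : ℤ) * v c - (weight S.O c' : ℤ) * v c')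
    {ℓ : ℕ} (hℓ : ℓ.Prime) (hℓN : ¬ ℓ ∣ Nplus * Nminus) :
    (p : ℤ) ∣ lam ℓ - (ℓ + 1) := by
  have hpZ : Prime (p : ℤ) := Nat.prime_iff_prime_int.mp hp
  have hw0 : ¬ (p : ℤ) ∣ (weight S.O c₀ : ℤ) * v c₀ := by
    intro h
    rcases hpZ.dvd_or_dvd h with h1 | h1
    · exact S.not_dvd_weight c₀ hp h5 (Int.natCast_dvd_natCast.mp h1)
    · exact hv0 h1
  exact dvd_sub_of_forall_dvd_weight_mul_sub (matrix S.O ℓ) (fun c => (weight S.O c : ℤ))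
    (fun i j => S.weight_mul_matrix_symm ℓ i j) (fun j => S.sum_matrix_prime_eq hℓ hℓN j)
    (hv ℓ hℓ hℓN) hpZ hw0 hcong

/-- **A non-Eisenstein eigenvalue produces non-congruent weighted coordinates**: with `S`, `v`,
`p ≥ 5`, `p ∤ v_{c₀}` as in `XiSetup.dvd_sub_prime_add_one_of_forall_dvd`, if one prime
`ℓ ∤ N⁺N⁻` has `λ(ℓ) ≢ ℓ + 1 (mod p)`, then `p ∤ w_c v_c - w_{c'} v_{c'}` for some classes
`c, c'` (contrapositive). For `v = g_r` this is "`p ∤ i_r`" in Takahashi's `δ i_r = h_r j_r`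
(Lemma 2.2: `i_r` generates `{⟨g_r, y⟩ : y ∈ ℤ[Cls O]⁰}`). [cite: Takahashi2001, Lemma 2.2] [cite: PollackWeston2011, Prop. 6.4 (1)] -/
theorem XiSetup.exists_not_dvd_weight_mul_sub (S : XiSetup Nplus Nminus)
    [Fintype (ClassSet S.O)] {lam : ℕ → ℤ} {v : ClassSet S.O → ℤ}
    (hv : v ∈ eigenLattice (Nplus * Nminus) (matrix S.O) lam) {p : ℕ} (hp : p.Prime)
    (h5 : 5 ≤ p) {c₀ : ClassSet S.O} (hv0 : ¬ (p : ℤ) ∣ v c₀)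
    {ℓ : ℕ} (hℓ : ℓ.Prime) (hℓN : ¬ ℓ ∣ Nplus * Nminus) (hne : ¬ (p : ℤ) ∣ lam ℓ - (ℓ + 1)) :
    ∃ c c' : ClassSet S.O, ¬ (p : ℤ) ∣ (weight S.O c : ℤ) * v c - (weight S.O c' : ℤ) * v c' := by
  by_contra h
  push Not at h
  exact hne (S.dvd_sub_prime_add_one_of_forall_dvd hv hp h5 hv0 h hℓ hℓN)

/-- **Degree-zero form**: under the hypotheses of `XiSetup.exists_not_dvd_weight_mul_sub` there is
a degree-zero vector `y ∈ ℤ[Cls O]⁰` (`Σ_c y_c = 0`, namely `y = e_c - e_{c'}`) whose Gross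
pairing with `v` is prime to `p`: `p ∤ ⟨v, y⟩ = Σ_c w_c v_c y_c`. In the dictionary
`X_r(J₀(rM)) ≅ ℤ[Cls O]⁰` (Ribet 1990 §3) this says that the functional `u_J(g_r, ·)` on the
character group is non-zero modulo `p`. [cite: Ribet1990, §3] [cite: Takahashi2001, Lemma 2.2] -/
theorem XiSetup.exists_sum_eq_zero_not_dvd_pairing (S : XiSetup Nplus Nminus)
    [Fintype (ClassSet S.O)] [DecidableEq (ClassSet S.O)] {lam : ℕ → ℤ} {v : ClassSet S.O → ℤ}
    (hv : v ∈ eigenLattice (Nplus * Nminus) (matrix S.O) lam) {p : ℕ} (hp : p.Prime)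
    (h5 : 5 ≤ p) {c₀ : ClassSet S.O} (hv0 : ¬ (p : ℤ) ∣ v c₀)
    {ℓ : ℕ} (hℓ : ℓ.Prime) (hℓN : ¬ ℓ ∣ Nplus * Nminus) (hne : ¬ (p : ℤ) ∣ lam ℓ - (ℓ + 1)) :
    ∃ y : ClassSet S.O → ℤ, ∑ c, y c = 0 ∧
      ¬ (p : ℤ) ∣ ∑ c, (weight S.O c : ℤ) * v c * y c := by
  obtain ⟨c, c', hcc'⟩ := S.exists_not_dvd_weight_mul_sub hv hp h5 hv0 hℓ hℓN hne
  have hne' : c ≠ c' := by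
    rintro rfl
    exact hcc' (by rw [sub_self]; exact dvd_zero _)
  refine ⟨Pi.single c 1 - Pi.single c' 1, ?_, ?_⟩
  · simp only [Pi.sub_apply, Pi.single_apply, Finset.sum_sub_distrib, Finset.sum_ite_eq',
      Finset.mem_univ, if_true, sub_self]
  · simp only [Pi.sub_apply, Pi.single_apply, mul_sub, mul_ite, mul_one, mul_zero,
      Finset.sum_sub_distrib, Finset.sum_ite_eq', Finset.mem_univ, if_true]
    exact hcc'

end Setup

/-! ### Generators of the eigen-lattice are primitive -/

section Primitive

variable {ι : Type*} [Fintype ι]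

/-- **A generator of the eigen-lattice is not divisible by any prime**: if `L(λ) = ℤ φ` with
`φ ≠ 0` then for every prime `p` some coordinate `φ_i` is prime to `p` — the eigen-lattice is
saturated (`Brandt.mem_eigenLattice_of_smul_mem`), so `φ = p ψ` would put `ψ = a φ` in it and give
`p a = 1`. (Takahashi 2001, p. 78: `g_r` generates the saturated line `L_r(J)`; this supplies the
hypothesis `p ∤ v_{c₀}` of the criteria above for `v = g_r`.) [folklore] -/
theorem exists_not_dvd_of_eigenLattice_eq_span {N : ℕ} {T : ℕ → Matrix ι ι ℤ} {lam : ℕ → ℤ}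
    {φ : ι → ℤ} (hφ : φ ≠ 0) (hL : eigenLattice N T lam = ℤ ∙ φ) {p : ℕ} (hp : p.Prime) :
    ∃ i, ¬ (p : ℤ) ∣ φ i := by
  by_contra h
  push Not at h
  choose ψ hψ using h
  have hφψ : φ = (p : ℤ) • (fun i => ψ i) := by
    funext i
    rw [Pi.smul_apply, smul_eq_mul]
    exact hψ i
  have hp0 : (p : ℤ) ≠ 0 := by exact_mod_cast hp.ne_zero
  have hψL : (fun i => ψ i) ∈ eigenLattice N T lam := by
    refine mem_eigenLattice_of_smul_mem hp0 ?_
    rw [← hφψ, hL]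
    exact Submodule.mem_span_singleton_self φ
  rw [hL] at hψL
  obtain ⟨a, ha⟩ := Submodule.mem_span_singleton.mp hψL
  -- `φ = p • ψ = p • a • φ`, so `(p a - 1) φ = 0` and `p a = 1`
  have h1 : ((p : ℤ) * a - 1) • φ = 0 := by
    rw [sub_smul, one_smul, mul_smul, ha, ← hφψ, sub_self]
  have hpa : (p : ℤ) * a = 1 := by
    have := (smul_eq_zero.mp h1).resolve_right hφ
    linarith [sub_eq_zero.mp this]
  have hp1 : (p : ℤ) = 1 := Int.eq_one_of_mul_eq_one_right (by exact_mod_cast p.zero_le) hpa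
  exact hp.one_lt.ne' (by exact_mod_cast hp1)

end Primitive

end Brandt

end Literature.NumberTheory.Automorphic

end
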